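import Literature.Topology.FourManifolds.RankOneFoldPoint
import Literature.Topology.FourManifolds.RankOneNormalForm
import Mathlib.Analysis.Calculus.FDeriv.CompCLM
import HarnessLib

/-!
# Indefinite fold points recognised intrinsically

Topic `Literature/Topology/FourManifolds`.  The textbook definition of an indefinite fold point
of a smooth map `F : ℝ⁴ → ℝ²` (Levine; Baykur–Saeki 2017, §2.1; Lekili 2009, §3): `dF_p` has
rank one, and the *intrinsic second derivative* — the Hessian of `ℓ ∘ F` at `p` for a covector
`ℓ ≠ 0` annihilating the image of `dF_p` (so that `p` is a critical point of `ℓ ∘ F`),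
restricted to `ker dF_p ≅ ℝ³` — is nondegenerate and indefinite.  We PROVE that such a point is
an indefinite fold point in the chart sense of `IsSimplifiedBrokenLefschetzFibration.fold`
(`HasIndefiniteFoldChart F p`): rank-one coordinates exist (`exists_rankOne_charts`), in them
the fibre gradient vanishes and the fibre Hessian is a nonzero multiple of the intrinsic one
(second-order chain rule), and `hasIndefiniteFoldChart_of_rankOneChart` applies.

* `fderiv_fderiv_comp_apply_eq_add` — the second-order chain rule
  `D²(F ∘ τ)(u)(v, w) = DF(τ u)(D²τ(u)(v, w)) + D²F(τ u)(Dτ v, Dτ w)`;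
* `exists_fderiv_continuousLinearEquiv` — the derivative of a local diffeomorphism is a
  linear isomorphism, with the derivative of the inverse as inverse;
* `hasIndefiniteFoldChart_of_kerHessian` — **the criterion**.

No named fact is introduced.

## References

* R. İ. Baykur, O. Saeki, *Simplifying indefinite fibrations on 4-manifolds*, arXiv:1705.11169
  (Trans. AMS 376, 2023), §2.1. [BaykurSaeki2017]
* Y. Lekili, *Wrinkled fibrations on near-symplectic manifolds*, Geom. Topol. 13 (2009), §3.
  [Lekili2009]
-/

noncomputable section

-- Instance search through the tower `E →L[ℝ] E →L[ℝ] ℝ` needs one more level of pending depth,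
-- as in `MorseLemma.lean` and `HadamardLemma.lean`.
set_option maxSynthPendingDepth 2

open Set Function Filter
open scoped Topology ContDiff

namespace Literature.Topology.FourManifolds

/-! ### Calculus: the second-order chain rule and derivatives of local diffeomorphisms -/

section Calculus

variable {E E' E'' : Type*} [NormedAddCommGroup E] [NormedSpace ℝ E] [NormedAddCommGroup E']
  [NormedSpace ℝ E'] [NormedAddCommGroup E''] [NormedSpace ℝ E'']

/-- **Second-order chain rule.**  If `F` is `C²` at `τ u₀` and `τ` is `C²` at `u₀` then
`D²(F ∘ τ)(u₀)(v, w) = DF(τ u₀)(D²τ(u₀)(v, w)) + D²F(τ u₀)(Dτ(u₀) v, Dτ(u₀) w)`. [folklore] -/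
theorem fderiv_fderiv_comp_apply_eq_add {F : E → E''} {τ : E' → E} {u₀ : E'}
    (hF : ContDiffAt ℝ 2 F (τ u₀)) (hτ : ContDiffAt ℝ 2 τ u₀) (v w : E') :
    fderiv ℝ (fderiv ℝ (F ∘ τ)) u₀ v w =
      fderiv ℝ F (τ u₀) (fderiv ℝ (fderiv ℝ τ) u₀ v w) +
        fderiv ℝ (fderiv ℝ F) (τ u₀) (fderiv ℝ τ u₀ v) (fderiv ℝ τ u₀ w) := by
  -- near `u₀`, `D(F ∘ τ)(u) = DF(τ u) ∘ Dτ(u)`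
  have hτd : ∀ᶠ u in 𝓝 u₀, DifferentiableAt ℝ τ u :=
    (hτ.eventually (by simp)).mono fun u hu => hu.differentiableAt (by simp)
  have hFd : ∀ᶠ z in 𝓝 (τ u₀), DifferentiableAt ℝ F z :=
    (hF.eventually (by simp)).mono fun z hz => hz.differentiableAt (by simp)
  have hFd' : ∀ᶠ u in 𝓝 u₀, DifferentiableAt ℝ F (τ u) := hτ.continuousAt.eventually hFd
  have heq : fderiv ℝ (F ∘ τ) =ᶠ[𝓝 u₀] fun u => (fderiv ℝ F (τ u)).comp (fderiv ℝ τ u) :=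
    (hFd'.and hτd).mono fun u hu => fderiv_comp u hu.1 hu.2
  rw [heq.fderiv_eq]
  have hc : HasFDerivAt (fun u => fderiv ℝ F (τ u))
      ((fderiv ℝ (fderiv ℝ F) (τ u₀)).comp (fderiv ℝ τ u₀)) u₀ := by
    have h1 : DifferentiableAt ℝ (fderiv ℝ F) (τ u₀) :=
      (hF.fderiv_right (m := 1) (by norm_num)).differentiableAt (by simp)
    have h2 : DifferentiableAt ℝ τ u₀ := hτ.differentiableAt (by simp)
    exact h1.hasFDerivAt.comp u₀ h2.hasFDerivAt
  have hd : HasFDerivAt (fun u => fderiv ℝ τ u) (fderiv ℝ (fderiv ℝ τ) u₀) u₀ :=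
    ((hτ.fderiv_right (m := 1) (by norm_num)).differentiableAt (by simp)).hasFDerivAt
  rw [(hc.clm_comp hd).fderiv]
  simp only [add_apply, ContinuousLinearMap.comp_apply, ContinuousLinearMap.flip_apply,
    ContinuousLinearMap.compL_apply]

/-- Second-order chain rule at a critical point: the term through `D²τ` vanishes.
[folklore] -/
theorem fderiv_fderiv_comp_apply_of_fderiv_eq_zero' {F : E → E''} {τ : E' → E} {u₀ : E'}
    (hF : ContDiffAt ℝ 2 F (τ u₀)) (hτ : ContDiffAt ℝ 2 τ u₀) (hcrit : fderiv ℝ F (τ u₀) = 0)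
    (v w : E') :
    fderiv ℝ (fderiv ℝ (F ∘ τ)) u₀ v w =
      fderiv ℝ (fderiv ℝ F) (τ u₀) (fderiv ℝ τ u₀ v) (fderiv ℝ τ u₀ w) := by
  rw [fderiv_fderiv_comp_apply_eq_add hF hτ, hcrit, zero_apply, zero_add]

/-- Second-order chain rule with a continuous linear inner map:
`D²(F ∘ L)(u)(v, w) = D²F(L u)(L v, L w)`. [folklore] -/
theorem fderiv_fderiv_comp_continuousLinearMap_apply {F : E → E''} (L : E' →L[ℝ] E) {u₀ : E'}
    (hF : ContDiffAt ℝ 2 F (L u₀)) (v w : E') :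
    fderiv ℝ (fderiv ℝ (F ∘ L)) u₀ v w = fderiv ℝ (fderiv ℝ F) (L u₀) (L v) (L w) := by
  rw [fderiv_fderiv_comp_apply_eq_add hF L.contDiff.contDiffAt, L.fderiv]
  have h0 : fderiv ℝ (fderiv ℝ (L : E' → E)) u₀ = 0 := by
    rw [show fderiv ℝ (L : E' → E) = fun _ => L from funext fun _ => L.fderiv]
    exact fderiv_const_apply _
  rw [h0]
  simp

/-- Second-order chain rule with a continuous linear outer map:
`D²(L ∘ f)(x)(v, w) = L (D²f(x)(v, w))`. [folklore] -/
theorem fderiv_fderiv_continuousLinearMap_comp_apply (L : E →L[ℝ] E'') {f : E' → E} {x : E'}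
    (hf : ContDiffAt ℝ 2 f x) (v w : E') :
    fderiv ℝ (fderiv ℝ (L ∘ f)) x v w = L (fderiv ℝ (fderiv ℝ f) x v w) := by
  rw [fderiv_fderiv_comp_apply_eq_add L.contDiff.contDiffAt hf, L.fderiv]
  have h0 : fderiv ℝ (fderiv ℝ (L : E → E'')) (f x) = 0 := by
    rw [show fderiv ℝ (L : E → E'') = fun _ => L from funext fun _ => L.fderiv]
    exact fderiv_const_apply _
  rw [h0]
  simp

/-- **The derivative of a local diffeomorphism is a linear isomorphism.**  For an open partial
homeomorphism `e` that is `Cⁿ` with `Cⁿ` inverse (`n ≥ 1`) and `x ∈ e.source`, there is a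
continuous linear equivalence `A` with `De(x) = A` and `D(e⁻¹)(e x) = A⁻¹`. [folklore] -/
theorem exists_fderiv_continuousLinearEquiv {n : WithTop ℕ∞} (e : OpenPartialHomeomorph E E')
    (he : ContDiffOn ℝ n e e.source) (hes : ContDiffOn ℝ n e.symm e.target) (hn : 1 ≤ n)
    {x : E} (hx : x ∈ e.source) :
    ∃ A : E ≃L[ℝ] E', HasFDerivAt e (A : E →L[ℝ] E') x ∧
      HasFDerivAt e.symm (A.symm : E' →L[ℝ] E) (e x) := by
  have hn0 : n ≠ 0 := by
    rintro rfl
    exact absurd hn (by simp)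
  have hD : HasFDerivAt e (fderiv ℝ e x) x :=
    ((he.contDiffAt (e.open_source.mem_nhds hx)).differentiableAt hn0).hasFDerivAt
  have hD' : HasFDerivAt e.symm (fderiv ℝ e.symm (e x)) (e x) :=
    ((hes.contDiffAt (e.open_target.mem_nhds (e.map_source hx))).differentiableAt
      hn0).hasFDerivAt
  -- `D(e⁻¹) ∘ De = id` and `De ∘ D(e⁻¹) = id`
  have h1 : (fderiv ℝ e.symm (e x)).comp (fderiv ℝ e x) = ContinuousLinearMap.id ℝ E := by
    have hc : HasFDerivAt (e.symm ∘ e) ((fderiv ℝ e.symm (e x)).comp (fderiv ℝ e x)) x :=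
      hD'.comp x hD
    have hi : HasFDerivAt (e.symm ∘ e) (ContinuousLinearMap.id ℝ E) x :=
      (hasFDerivAt_id x).congr_of_eventuallyEq (e.eventually_left_inverse hx)
    exact hc.unique hi
  have h2 : (fderiv ℝ e x).comp (fderiv ℝ e.symm (e x)) = ContinuousLinearMap.id ℝ E' := by
    have hD'' : HasFDerivAt e (fderiv ℝ e x) (e.symm (e x)) := by
      rw [e.left_inv hx]
      exact hD
    have hc : HasFDerivAt (e ∘ e.symm) ((fderiv ℝ e x).comp (fderiv ℝ e.symm (e x))) (e x) :=
      hD''.comp (e x) hD'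
    have hi : HasFDerivAt (e ∘ e.symm) (ContinuousLinearMap.id ℝ E') (e x) :=
      (hasFDerivAt_id (e x)).congr_of_eventuallyEq
        (e.eventually_right_inverse (e.map_source hx))
    exact hc.unique hi
  refine ⟨ContinuousLinearEquiv.equivOfInverse (fderiv ℝ e x) (fderiv ℝ e.symm (e x))
    (fun v => ?_) (fun v => ?_), hD, hD'⟩
  · have := congrArg (fun T : E →L[ℝ] E => T v) h1
    simpa using this
  · have := congrArg (fun T : E' →L[ℝ] E' => T v) h2
    simpa using this

end Calculus

/-! ### The criterion -/

/-- Local notation: `𝔼 n` is the model Euclidean space `EuclideanSpace ℝ (Fin n)`. -/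
local notation "𝔼 " n:arg => EuclideanSpace ℝ (Fin n)

/-- Expansion of a vector of `ℝ²` in the standard basis. [folklore] -/
theorem eq_smul_single_add_smul_single (u : 𝔼 2) :
    u = (u 0) • EuclideanSpace.single (0 : Fin 2) (1 : ℝ) +
      (u 1) • EuclideanSpace.single (1 : Fin 2) (1 : ℝ) := by
  ext i
  fin_cases i <;> simp
set_option maxHeartbeats 400000 in -- buildfix (bf3-g26): 160k/180k FAIL, 200k PASS at accept time; line-neutral budget line
/-- **Indefinite fold points recognised by the intrinsic second derivative.**  Let
`F : ℝ⁴ → ℝ²` be `C^∞`, `p` a point with `dF_p ≠ 0`, and `ℓ ≠ 0` a linear form on `ℝ²` with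
`ℓ ∘ dF_p = 0` (so `dF_p` has rank one and `p` is a critical point of `ℓ ∘ F`).  If the Hessian
of `ℓ ∘ F` at `p` restricted to `ker dF_p` is nondegenerate and indefinite, then `p` is an
indefinite fold point of `F`: `HasIndefiniteFoldChart F p`, i.e. there are smooth charts in
which `F = (t, x² + y² - z²)` (Baykur–Saeki 2017, §2.1; Lekili 2009, §3; the fold condition of
Levine).  Proof: rank-one coordinates (`exists_rankOne_charts`), the second-order chain rule,
and `hasIndefiniteFoldChart_of_rankOneChart`. [cite: BaykurSaeki2017, §2.1] -/
theorem hasIndefiniteFoldChart_of_kerHessian {F : 𝔼 4 → 𝔼 2} (hF : ContDiff ℝ ∞ F) {p : 𝔼 4}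
    (hp : fderiv ℝ F p ≠ 0) {ℓ : 𝔼 2 →L[ℝ] ℝ} (hℓ : ℓ ≠ 0) (hℓF : ℓ.comp (fderiv ℝ F p) = 0)
    (hH : ∀ v : 𝔼 4, fderiv ℝ F p v = 0 →
      (∀ w : 𝔼 4, fderiv ℝ F p w = 0 → fderiv ℝ (fderiv ℝ (fun q => ℓ (F q))) p v w = 0) →
        v = 0)
    (hneg : ∃ v : 𝔼 4, fderiv ℝ F p v = 0 ∧ fderiv ℝ (fderiv ℝ (fun q => ℓ (F q))) p v v < 0)
    (hpos : ∃ w : 𝔼 4, fderiv ℝ F p w = 0 ∧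
      0 < fderiv ℝ (fderiv ℝ (fun q => ℓ (F q))) p w w) :
    HasIndefiniteFoldChart F p := by
  have h2 : (2 : WithTop ℕ∞) ≤ ∞ := WithTop.coe_le_coe.2 le_top
  set e0 : 𝔼 2 := EuclideanSpace.single (0 : Fin 2) (1 : ℝ) with he0
  set e1 : 𝔼 2 := EuclideanSpace.single (1 : Fin 2) (1 : ℝ) with he1
  set h : 𝔼 4 → ℝ := fun q => ℓ (F q) with hh_def
  have hFd : ∀ q, HasFDerivAt F (fderiv ℝ F q) q := fun q =>
    (hF.differentiable (by simp) q).hasFDerivAt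
  have hhcrit : fderiv ℝ h p = 0 := by
    have hd : HasFDerivAt h (ℓ.comp (fderiv ℝ F p)) p := ℓ.hasFDerivAt.comp p (hFd p)
    rw [hd.fderiv]
    exact hℓF
  -- Step 1: rank-one coordinates
  obtain ⟨φ, ψ, f, hpφ, hp0, hmaps, hφ, hφs, hψ, hψs, hf, hid⟩ := exists_rankOne_charts hF hp
  have h0t : (0 : 𝔼 4) ∈ φ.target := hp0 ▸ φ.map_source hpφ
  have hφp : φ.symm 0 = p := by rw [← hp0, φ.left_inv hpφ]
  have hFpψ : F p ∈ ψ.source := hmaps hpφ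
  obtain ⟨A, hAd, hAsd⟩ := exists_fderiv_continuousLinearEquiv φ hφ hφs (by simp) hpφ
  rw [hp0] at hAsd
  obtain ⟨B, hBd, hBsd⟩ := exists_fderiv_continuousLinearEquiv ψ hψ hψs (by simp) hFpψ
  -- the representative `G = (y₀, f y)` and the identity `ψ ∘ F ∘ φ⁻¹ = G` on `φ.target`
  set G : 𝔼 4 → 𝔼 2 := fun y => (y 0) • e0 + f y • e1 with hG_def
  have hGev : ∀ y ∈ φ.target, ψ (F (φ.symm y)) = G y := by
    intro y hy
    obtain ⟨h0', h1'⟩ := hid (φ.symm y) (φ.map_target hy)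
    rw [φ.right_inv hy] at h0' h1'
    rw [eq_smul_single_add_smul_single (ψ (F (φ.symm y))), h0', h1']
  have hG0 : G 0 = ψ (F p) := by rw [← hGev 0 h0t, hφp]
  have hfc : ContDiffAt ℝ ∞ f 0 := hf.contDiffAt (φ.open_target.mem_nhds h0t)
  have hP0d : ∀ y : 𝔼 4, HasFDerivAt (fun q : 𝔼 4 => q 0)
      (EuclideanSpace.proj (0 : Fin 4) : 𝔼 4 →L[ℝ] ℝ) y := fun y =>
    (EuclideanSpace.proj (0 : Fin 4) : 𝔼 4 →L[ℝ] ℝ).hasFDerivAt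
  set D : 𝔼 4 →L[ℝ] 𝔼 2 := (EuclideanSpace.proj (0 : Fin 4) : 𝔼 4 →L[ℝ] ℝ).smulRight e0 +
    (fderiv ℝ f 0).smulRight e1 with hD_def
  have hGd : HasFDerivAt G D 0 :=
    ((hP0d 0).smul_const e0).add ((hfc.differentiableAt (by simp)).hasFDerivAt.smul_const e1)
  have hDv : ∀ v : 𝔼 4, D v = (v 0) • e0 + (fderiv ℝ f 0 v) • e1 := fun v => by
    simp [hD_def]
  -- `F ∘ φ⁻¹ = ψ⁻¹ ∘ G` near `0`, hence `dF_p ∘ A⁻¹ = B⁻¹ ∘ D`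
  have hnear : ∀ᶠ y in 𝓝 (0 : 𝔼 4), y ∈ φ.target := φ.open_target.mem_nhds h0t
  have hev1 : (fun y => F (φ.symm y)) =ᶠ[𝓝 0] fun y => ψ.symm (G y) := by
    filter_upwards [hnear] with y hy
    rw [← hGev y hy, ψ.left_inv (hmaps (φ.map_target hy))]
  have hFd' : HasFDerivAt F (fderiv ℝ F p) (φ.symm 0) := by
    rw [hφp]
    exact hFd p
  have hBsd' : HasFDerivAt ψ.symm (B.symm : 𝔼 2 →L[ℝ] 𝔼 2) (G 0) := by
    rw [hG0]
    exact hBsd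
  have hc1 : HasFDerivAt (fun y => F (φ.symm y)) ((fderiv ℝ F p).comp (A.symm : 𝔼 4 →L[ℝ] 𝔼 4))
      0 := hFd'.comp 0 hAsd
  have hc2 : HasFDerivAt (fun y => ψ.symm (G y)) ((B.symm : 𝔼 2 →L[ℝ] 𝔼 2).comp D) 0 :=
    hBsd'.comp 0 hGd
  have hDeq : (fderiv ℝ F p).comp (A.symm : 𝔼 4 →L[ℝ] 𝔼 4) =
      (B.symm : 𝔼 2 →L[ℝ] 𝔼 2).comp D := hc1.unique (hc2.congr_of_eventuallyEq hev1)
  have hDeq' : ∀ v : 𝔼 4, fderiv ℝ F p (A.symm v) = B.symm (D v) := fun v => by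
    have := congrArg (fun T : 𝔼 4 →L[ℝ] 𝔼 2 => T v) hDeq
    simpa using this
  -- Step 2: the fibre partial derivatives of `f` vanish at `0`
  set ℓ' : 𝔼 2 →L[ℝ] ℝ := ℓ.comp (B.symm : 𝔼 2 →L[ℝ] 𝔼 2) with hℓ'_def
  have hℓ'D : ∀ v : 𝔼 4, ℓ' (D v) = 0 := fun v => by
    have h1 : ℓ' (D v) = ℓ (fderiv ℝ F p (A.symm v)) := by
      rw [hDeq' v]
      rfl
    rw [h1]
    simpa using congrArg (fun T : 𝔼 4 →L[ℝ] ℝ => T (A.symm v)) hℓF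
  have hℓ'v : ∀ v : 𝔼 4, (v 0) * ℓ' e0 + (fderiv ℝ f 0 v) * ℓ' e1 = 0 := fun v => by
    have := hℓ'D v
    rwa [hDv, map_add, map_smul, map_smul, smul_eq_mul, smul_eq_mul] at this
  have hℓ'e1 : ℓ' e1 ≠ 0 := by
    intro h1
    have h0' : ℓ' e0 = 0 := by
      have := hℓ'v (EuclideanSpace.single (0 : Fin 4) (1 : ℝ))
      rw [h1, mul_zero, add_zero] at this
      simpa using this
    apply hℓ
    ext u
    have hu : ℓ' (B u) = ℓ u := by simp [hℓ'_def]
    rw [← hu, eq_smul_single_add_smul_single (B u), map_add, map_smul, map_smul, ← he0, ← he1,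
      h0', h1]
    simp
  have hfib : ∀ v : 𝔼 4, v 0 = 0 → fderiv ℝ f 0 v = 0 := fun v hv => by
    have := hℓ'v v
    rw [hv, zero_mul, zero_add] at this
    exact (mul_eq_zero.1 this).resolve_right hℓ'e1
  have hunf0 : unfibre ((0 : ℝ), (0 : 𝔼 3)) = 0 := map_zero unfibre
  have hfu : ∀ x : ℝ × 𝔼 3, fderiv ℝ (f ∘ unfibre) ((0 : ℝ), (0 : 𝔼 3)) x =
      fderiv ℝ f 0 (unfibre x) := fun x => by
    have hd : HasFDerivAt (f ∘ unfibre) ((fderiv ℝ f 0).comp unfibre) ((0 : ℝ), (0 : 𝔼 3)) := by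
      have hf0 : HasFDerivAt f (fderiv ℝ f 0) (unfibre ((0 : ℝ), (0 : 𝔼 3))) := by
        rw [hunf0]
        exact (hfc.differentiableAt (by simp)).hasFDerivAt
      exact hf0.comp _ unfibre.hasFDerivAt
    rw [hd.fderiv, ContinuousLinearMap.comp_apply]
  have hcrit : fibreGrad (f ∘ unfibre) (0, 0) = 0 := by
    ext i
    rw [fibreGrad_apply, hfu]
    exact hfib _ (by simp)
  -- Step 3: the fibre Hessian of `f` is `c⁻¹` times the kernel Hessian of `ℓ ∘ F`
  set m : 𝔼 2 → ℝ := fun z => ℓ (ψ.symm z) with hm_def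
  have hmc : ContDiffAt ℝ 2 m (G 0) := by
    have hψc : ContDiffAt ℝ ∞ ψ.symm (G 0) := by
      rw [hG0]
      exact hψs.contDiffAt (ψ.open_target.mem_nhds (ψ.map_source hFpψ))
    exact (ℓ.contDiff.contDiffAt.comp (G 0) hψc).of_le h2
  have hmd : fderiv ℝ m (G 0) = ℓ' := (ℓ.hasFDerivAt.comp (G 0) hBsd').fderiv
  have hGc : ContDiffAt ℝ 2 G 0 :=
    ((((EuclideanSpace.proj (0 : Fin 4) : 𝔼 4 →L[ℝ] ℝ).contDiff.contDiffAt).smul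
      contDiffAt_const).add (hfc.smul contDiffAt_const)).of_le h2
  have hev2 : (h ∘ φ.symm) =ᶠ[𝓝 0] (m ∘ G) := by
    filter_upwards [hnear] with y hy
    show ℓ (F (φ.symm y)) = ℓ (ψ.symm (G y))
    rw [← hGev y hy, ψ.left_inv (hmaps (φ.map_target hy))]
  -- second derivative of `G`: only `f • e1` contributes
  have hD2G : ∀ v w : 𝔼 4, fderiv ℝ (fderiv ℝ G) 0 v w = (fderiv ℝ (fderiv ℝ f) 0 v w) • e1 := by
    intro v w
    set Le1 : ℝ →L[ℝ] 𝔼 2 := (1 : ℝ →L[ℝ] ℝ).smulRight e1 with hLe1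
    set G₁ : 𝔼 4 →L[ℝ] 𝔼 2 := (EuclideanSpace.proj (0 : Fin 4) : 𝔼 4 →L[ℝ] ℝ).smulRight e0
      with hG₁
    have hGsplit : G = fun y => G₁ y + (Le1 ∘ f) y := by
      funext y
      simp [hG_def, hG₁, hLe1]
    -- near `0`, `DG(y) = G₁ + D(Le1 ∘ f)(y)`
    have hfdn : ∀ᶠ y in 𝓝 (0 : 𝔼 4), DifferentiableAt ℝ f y :=
      ((hfc.of_le h2).eventually (by simp)).mono fun y hy => hy.differentiableAt (by simp)
    have hevD : fderiv ℝ G =ᶠ[𝓝 0] fun y => G₁ + fderiv ℝ (Le1 ∘ f) y := by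
      filter_upwards [hfdn] with y hy
      rw [hGsplit]
      have h2' : DifferentiableAt ℝ (Le1 ∘ f) y := Le1.differentiableAt.comp y hy
      have hy' : HasFDerivAt (fun y => G₁ y + (Le1 ∘ f) y) (G₁ + fderiv ℝ (Le1 ∘ f) y) y :=
        G₁.hasFDerivAt.add h2'.hasFDerivAt
      rw [hy'.fderiv]
    rw [hevD.fderiv_eq, fderiv_const_add,
      fderiv_fderiv_continuousLinearMap_comp_apply Le1 (hfc.of_le h2)]
    simp [hLe1]
  have hkey : ∀ v w : 𝔼 4, v 0 = 0 →
      fderiv ℝ (fderiv ℝ h) p (A.symm v) (A.symm w) =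
        ℓ' e1 * fderiv ℝ (fderiv ℝ f) 0 v w := by
    intro v w hv
    have hφc : ContDiffAt ℝ 2 φ.symm 0 :=
      (hφs.contDiffAt (φ.open_target.mem_nhds h0t)).of_le h2
    have hhc : ContDiffAt ℝ 2 h (φ.symm 0) := by
      rw [hφp]
      exact (ℓ.contDiff.comp hF).contDiffAt.of_le h2
    have hhcrit' : fderiv ℝ h (φ.symm 0) = 0 := by rw [hφp]; exact hhcrit
    have hL := fderiv_fderiv_comp_apply_of_fderiv_eq_zero' hhc hφc hhcrit' v w
    rw [hAsd.fderiv, hφp] at hL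
    have hR := fderiv_fderiv_comp_apply_eq_add hmc hGc v w
    rw [hGd.fderiv, hmd, hD2G, map_smul, smul_eq_mul] at hR
    have hDv0 : D v = 0 := by rw [hDv, hv, hfib v hv, zero_smul, zero_smul, add_zero]
    rw [hDv0, map_zero, zero_apply, add_zero] at hR
    have heq : fderiv ℝ (fderiv ℝ (h ∘ φ.symm)) 0 = fderiv ℝ (fderiv ℝ (m ∘ G)) 0 :=
      hev2.fderiv.fderiv_eq
    have hL' : fderiv ℝ (fderiv ℝ (h ∘ φ.symm)) 0 v w =
        fderiv ℝ (fderiv ℝ h) p (A.symm v) (A.symm w) := hL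
    rw [← hL', heq, hR, mul_comm]
  -- the fibre Hessian of `f ∘ unfibre`
  have hfibH : ∀ a b : 𝔼 3, fibreHessian (f ∘ unfibre) (0, 0) a b =
      fderiv ℝ (fderiv ℝ f) 0 (unfibre ((0 : ℝ), a)) (unfibre ((0 : ℝ), b)) := by
    intro a b
    rw [fibreHessian_apply, fderiv_fderiv_comp_continuousLinearMap_apply unfibre, hunf0]
    rw [hunf0]
    exact hfc.of_le h2
  -- vectors `v` with `v₀ = 0` correspond to `ker dF_p` under `A⁻¹`
  have hker : ∀ v : 𝔼 4, v 0 = 0 → fderiv ℝ F p (A.symm v) = 0 := fun v hv => by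
    rw [hDeq' v, hDv, hv, hfib v hv, zero_smul, zero_smul, add_zero, map_zero]
  have hker' : ∀ k : 𝔼 4, fderiv ℝ F p k = 0 → (A k) 0 = 0 := fun k hk => by
    have h1 : B.symm (D (A k)) = 0 := by rw [← hDeq' (A k), A.symm_apply_apply, hk]
    have h2' : D (A k) = 0 := B.symm.injective (by rw [h1, map_zero])
    have h3 := congrArg (fun u : 𝔼 2 => u 0) h2'
    simpa [hDv, he0, he1] using h3
  have hunf : ∀ v : 𝔼 4, v 0 = 0 → unfibre ((0 : ℝ), fibrePart v) = v := fun v hv => by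
    rw [← hv]
    exact unfibre_fibrePart v
  -- Step 4: transfer nondegeneracy and indefiniteness
  have hc0 : ℓ' e1 ≠ 0 := hℓ'e1
  have hH' : ∀ a : 𝔼 3, (∀ b, fibreHessian (f ∘ unfibre) (0, 0) a b = 0) → a = 0 := by
    intro a ha
    set ua : 𝔼 4 := unfibre ((0 : ℝ), a) with hua
    have hua0 : ua 0 = 0 := by simp [hua]
    have hz : A.symm ua = 0 := by
      refine hH (A.symm ua) (hker ua hua0) fun k hk => ?_
      have hk0 : (A k) 0 = 0 := hker' k hk
      have h1 := hkey ua (A k) hua0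
      rw [A.symm_apply_apply] at h1
      rw [h1, ← hunf (A k) hk0, ← hfibH, ha, mul_zero]
    have hua' : ua = 0 := by simpa using congrArg A hz
    have := congrArg fibrePart hua'
    simpa [hua] using this
  -- a kernel vector with a sign gives a fibre vector with sign `sign(c) * sign`
  have hsign : ∀ k : 𝔼 4, fderiv ℝ F p k = 0 →
      fderiv ℝ (fderiv ℝ h) p k k =
        ℓ' e1 * fibreHessian (f ∘ unfibre) (0, 0) (fibrePart (A k)) (fibrePart (A k)) := by
    intro k hk
    have hk0 : (A k) 0 = 0 := hker' k hk
    have h1 := hkey (A k) (A k) hk0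
    rw [A.symm_apply_apply] at h1
    rw [h1, hfibH, hunf (A k) hk0]
  obtain ⟨v, hvK, hvneg⟩ := hneg
  obtain ⟨w, hwK, hwpos⟩ := hpos
  rw [hsign v hvK] at hvneg
  rw [hsign w hwK] at hwpos
  have hneg' : ∃ a : 𝔼 3, fibreHessian (f ∘ unfibre) (0, 0) a a < 0 := by
    rcases mul_neg_iff.1 hvneg with ⟨hc, ha⟩ | ⟨hc, ha⟩
    · exact ⟨_, ha⟩
    · rcases mul_pos_iff.1 hwpos with ⟨hc', _⟩ | ⟨_, hb⟩
      · exact absurd hc' (not_lt.2 hc.le)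
      · exact ⟨_, hb⟩
  have hpos' : ∃ b : 𝔼 3, 0 < fibreHessian (f ∘ unfibre) (0, 0) b b := by
    rcases mul_pos_iff.1 hwpos with ⟨hc, hb⟩ | ⟨hc, hb⟩
    · exact ⟨_, hb⟩
    · rcases mul_neg_iff.1 hvneg with ⟨hc', _⟩ | ⟨_, ha⟩
      · exact absurd hc' (not_lt.2 hc.le)
      · exact ⟨_, ha⟩
  exact hasIndefiniteFoldChart_of_rankOneChart hpφ hp0 hmaps hφ hφs hψ hψs hf hid hcrit hH'
    hneg' hpos'

end Literature.Topology.FourManifolds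

end
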